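import Literature.Analysis.FunctionSpaces.SpinorWightmanPCTIdentityFam
import Literature.Analysis.FunctionSpaces.SpinorWightmanCombVanishing
import Literature.MathematicalPhysics.QuantumLattice.SL2CPCTMatrixConj
import HarnessLib

/-!
# Spinor Wightman fields: the wrong-parity part of every multiplet vanishes, and Wightman
functions with an odd number of Fermi fields vanish

Topic `Literature/Analysis/FunctionSpaces`, on the way to `Literature.Analysis.FunctionSpaces.pct_theorem`
(Streater–Wightman (1964), §4-3 Thm. 4-7; the input of §4-4 Thm. 4-10 in basis-free form). For a
species `k` of a spinor theory let `J = S^{(k)}(−1)` (central, `J² = 1`), `s = −1` for a Fermi and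
`s = +1` for a Bose species, and `P_w = ½(1 − sJ)` the projection onto the part of the multiplet with
the *wrong* connection of spin with statistics (`J = −s`).

* `twoPt_pct` — the `n = 2` PCT identity for the pair `(φ_{(k,a)†}, φ_{(k,b)})` of an adjoint and a
  species multiplet (`SpinorWightmanPCTIdentity` for the families `adjFamily k`, `speciesFamily k`,
  with `pctMatrix S̄ = conj (pctMatrix S · J)` from `SL2CPCTMatrixConj`):
  `⟪φ_a(h)Ω, φ_b(h)Ω⟫ = s ∑ conj((CJ)_{aa'}) C_{bb'} ⟪φ_{b'†}(h̃)Ω, φ_{a'†}(h̃)Ω⟫`;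
* `wrongProj_field_vacuum_eq_zero` — **positivity**: for a left `(−s)`-eigenvector `c` of `J`,
  `‖∑ cₐ φ_a(h) Ω‖² = −‖…‖²`, so `∑_β (P_w)_{αβ} φ_{k,β}(h) Ω = 0`; hence, by Thm. 4-3 for
  combinations (`SpinorWightmanCombVanishing`), `∑_β (P_w)_{αβ} φ_{k,β}(h) = 0` on `D`
  (`wrongProj_field_eq_zero`) and **`∑_β J_{αβ} φ_{k,β} = s φ_{k,α}`** (`sum_S_neg_one_field`);
* `spinRep_neg_one_cmonomialVec` — the rotation by `2π` acts on a monomial vector by `(−1)^F`,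
  `F` the number of Fermi letters; therefore (`wightmanFn_eq_zero_of_odd`) **Wightman functions
  with an odd number of Fermi fields vanish** (invariance of `Ω` under `U(−1)`).

## References

* R. F. Streater, A. S. Wightman, *PCT, Spin and Statistics, and All That* (1964; Princeton 2000),
  §4-3 Thm. 4-7, §4-4 Thm. 4-10 eqs. (4-51)–(4-54). [StreaterWightman1964]
-/

noncomputable section

open Filter MeasureTheory Set ComplexConjugate Complex
open _root_.Topology
open scoped InnerProductSpace SchwartzMap MatrixGroups
open Literature.MathematicalPhysics Literature.MathematicalPhysics.QuantumLattice

namespace Literature.Analysis.FunctionSpaces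

variable {κ : Type*}

/-- Swapping the two pairs of a fourfold sum. [folklore] -/
theorem sum_comm_pairs {ι : Type*} [Fintype ι] {M : Type*} [AddCommMonoid M] (U : ι → ι → ι → ι → M) :
    ∑ a, ∑ b, ∑ c, ∑ d, U a b c d = ∑ c, ∑ d, ∑ a, ∑ b, U a b c d := by
  have e1 : ∑ a, ∑ b, ∑ c, ∑ d, U a b c d = ∑ p : ι × ι, ∑ q : ι × ι, U p.1 p.2 q.1 q.2 := by
    rw [← Fintype.sum_prod_type']
    refine Finset.sum_congr rfl fun p _ => ?_
    rw [← Fintype.sum_prod_type']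
  have e2 : ∑ c, ∑ d, ∑ a, ∑ b, U a b c d = ∑ q : ι × ι, ∑ p : ι × ι, U p.1 p.2 q.1 q.2 := by
    rw [← Fintype.sum_prod_type']
    refine Finset.sum_congr rfl fun q _ => ?_
    rw [← Fintype.sum_prod_type']
  rw [e1, e2, Finset.sum_comm]

namespace SpinorWightmanData

variable (W : SpinorWightmanData κ)

/-! ### The wrong-parity projection -/

/-- The statistics sign of a species: `s = −1` for Fermi, `+1` for Bose. [cite: StreaterWightman1964, §4-4 Thm 4-10] -/
def statSign (k : κ) : ℂ := if W.isFermi k then -1 else 1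

/-- `s² = 1`. [folklore] -/
theorem statSign_mul_self (k : κ) : W.statSign k * W.statSign k = 1 := by
  unfold statSign; split_ifs <;> norm_num

/-- `s` is real. [folklore] -/
theorem conj_statSign (k : κ) : conj (W.statSign k) = W.statSign k := by
  unfold statSign; split_ifs <;> simp

/-- `S(−1)² = 1`. [folklore] -/
theorem S_neg_one_mul_self (k : κ) : W.S k (-1) * W.S k (-1) = 1 := by
  rw [← map_mul]; simp

/-- `S(−1)` is central. [folklore] -/
theorem S_neg_one_comm (k : κ) (A : SL(2, ℂ)) : W.S k (-1) * W.S k A = W.S k A * W.S k (-1) := by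
  rw [← map_mul, ← map_mul, neg_one_mul, mul_neg_one]

/-- The **wrong-parity projection** `P_w = ½(1 − s S(−1))` of the multiplet `k` (onto `S(−1) = −s`).
[cite: StreaterWightman1964, §4-4 Thm 4-10] -/
def wrongProj (k : κ) : Matrix (Fin (W.mult k)) (Fin (W.mult k)) ℂ := (2⁻¹ : ℂ) • (1 - W.statSign k • W.S k (-1))

/-- `P_w S(−1) = −s P_w`. [folklore] -/
theorem wrongProj_mul_S_neg_one (k : κ) : W.wrongProj k * W.S k (-1) = -(W.statSign k • W.wrongProj k) := by
  rw [eq_neg_iff_add_eq_zero, wrongProj, smul_mul_assoc, smul_smul, mul_comm (W.statSign k) 2⁻¹, ← smul_smul, ← smul_add,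
    sub_mul, one_mul, smul_mul_assoc, S_neg_one_mul_self, smul_sub, smul_smul, statSign_mul_self, one_smul,
    sub_add_sub_cancel, sub_self, smul_zero]

/-- The product of the statistics signs of the letters of a monomial. [folklore] -/
def listStatSign (l : List W.CLetter) : ℂ := (l.map fun p => W.statSign p.1.1).prod

/-- The sign product of species letters is `(−1)^F`. [folklore] -/
theorem listStatSign_ofFn {n : ℕ} (i : Fin n → W.Idx) (f : Fin n → 𝓢(SpaceTime 3, ℂ)) :
    W.listStatSign (List.ofFn fun j => (i j, f j)) = (-1) ^ (Finset.univ.filter fun j => W.isFermi (i j).1 = true).card := by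
  rw [listStatSign, List.map_ofFn, List.prod_ofFn]
  simp only [Function.comp_def, statSign]
  rw [Finset.prod_ite, Finset.prod_const_one, mul_one, Finset.prod_const]

/-- The product of the statistics signs is `(−1)^F`. [folklore] -/
theorem prod_statSign {n : ℕ} (k : Fin n → κ) :
    ∏ j, W.statSign (k j) = (-1) ^ (Finset.univ.filter fun j => W.isFermi (k j) = true).card := by
  simp only [statSign]
  rw [Finset.prod_ite, Finset.prod_const_one, mul_one, Finset.prod_const]

end SpinorWightmanData

/-! ### The `n = 2` PCT identity for a pair of families -/

namespace IsSpinorWightmanQFT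

open SpinorWightmanData

variable {W : SpinorWightmanData κ}

/-- Two-point functions of letters as inner products: `𝒲(i₀ i₁)(f₀, f₁) = ⟪Ω, φ_{i₀}(f₀) φ_{i₁}(f₁) Ω⟫`. [folklore] -/
theorem cWightmanFn_two (i₀ i₁ : W.Idx) (f₀ f₁ : 𝓢(SpaceTime 3, ℂ)) :
    W.cWightmanFn 2 ![i₀, i₁] ![f₀, f₁] = ⟪W.vacuum, (W.cfield i₀ f₀ (W.cfield i₁ f₁ W.vacuumDom) : W.H)⟫_ℂ := by
  rw [SpinorWightmanData.cWightmanFn, SpinorWightmanData.cmonomialVec]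
  congr 2

/-- **The PCT identity for two families** (`n = 2` of `cWightmanFn_eq_pct`):
`⟪Ω, φ_{Φ₀ a}(f₀) φ_{Φ₁ b}(f₁) Ω⟫ = σ ∑_{a',b'} C₀(a,a') C₁(b,b') ⟪Ω, φ_{Φ₁ b'}(f̂₁) φ_{Φ₀ a'}(f̂₀) Ω⟫`.
[cite: StreaterWightman1964, §4-3 Thm 4-7 eq. (4-19)] -/
theorem cWightmanFn_two_eq_pct (hW : IsSpinorWightmanQFT W) (Φ₀ Φ₁ : W.CovFamily) (a : Fin Φ₀.m) (b : Fin Φ₁.m)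
    (f₀ f₁ : 𝓢(SpaceTime 3, ℂ)) :
    W.cWightmanFn 2 ![Φ₀.idx a, Φ₁.idx b] ![f₀, f₁] =
      (if (Φ₀.fermi && Φ₁.fermi) = true then (-1 : ℂ) else 1) *
        ∑ a', ∑ b', SL2C.pctMatrix Φ₀.R Φ₀.continuous_R a a' * SL2C.pctMatrix Φ₁.R Φ₁.continuous_R b b' *
          W.cWightmanFn 2 ![Φ₁.idx b', Φ₀.idx a'] ![reflectTest f₁, reflectTest f₀] := by
  set Φ : Fin 2 → W.CovFamily := ![Φ₀, Φ₁] with hΦ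
  set e := piFinTwoEquiv fun j => Fin (Φ j).m with he
  have h := hW.cWightmanFn_eq_pct Φ (e.symm (a, b)) ![f₀, f₁]
  have hl : (fun j => (Φ j).idx (e.symm (a, b) j)) = ![Φ₀.idx a, Φ₁.idx b] := by
    funext j; fin_cases j <;> rfl
  have hσ : fermiPairSign (List.ofFn fun j => (Φ j).fermi) = if (Φ₀.fermi && Φ₁.fermi) = true then (-1 : ℂ) else 1 := by
    simp [List.ofFn_succ, hΦ]
  rw [hl, hσ] at h
  rw [h]
  congr 1
  rw [← e.symm.sum_comp, Fintype.sum_prod_type]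
  refine Finset.sum_congr rfl fun a' _ => Finset.sum_congr rfl fun b' _ => ?_
  have hl' : (fun j => (Φ (Fin.rev j)).idx (e.symm (a', b') (Fin.rev j))) = ![Φ₁.idx b', Φ₀.idx a'] := by
    funext j; fin_cases j <;> rfl
  have hf' : (fun j => reflectTest (![f₀, f₁] (Fin.rev j))) = ![reflectTest f₁, reflectTest f₀] := by
    funext j; fin_cases j <;> rfl
  rw [hl', hf', Fin.prod_univ_two]
  rfl

/-! ### The two-point PCT identity for a species and positivity -/

/-- `(f̄)^ = conj (f̂)`: reflection commutes with conjugation. [folklore] -/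
theorem reflectTest_starTest (f : 𝓢(SpaceTime 3, ℂ)) : reflectTest (starTest f) = starTest (reflectTest f) := by
  ext x; simp [reflectTest_apply, starTest_apply]

/-- **The two-point PCT identity for a species** (S–W (4-45)/(4-52) in basis-free form): with
`t_a = φ_{k,a}(h) Ω`, `u_a = φ_{(k,a)†}(conj ĥ) Ω`, `C = pctMatrix S^{(k)}`, `J = S^{(k)}(−1)`:
`⟪t_a, t_b⟫ = s ∑_{a',b'} conj((CJ)_{aa'}) C_{bb'} ⟪u_{b'}, u_{a'}⟫`. [cite: StreaterWightman1964, §4-4 eq. (4-52)] -/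
theorem twoPt_pct (hW : IsSpinorWightmanQFT W) (k : κ) (a b : Fin (W.mult k)) (h : 𝓢(SpaceTime 3, ℂ)) :
    ⟪(W.cfield ⟨k, a⟩ h W.vacuumDom : W.H), (W.cfield ⟨k, b⟩ h W.vacuumDom : W.H)⟫_ℂ =
      W.statSign k * ∑ a', ∑ b',
        conj ((SL2C.pctMatrix (W.S k) (hW.continuous_S k) * W.S k (-1)) a a') *
          SL2C.pctMatrix (W.S k) (hW.continuous_S k) b b' *
          ⟪(W.cfield (hW.adj ⟨k, b'⟩) (starTest (reflectTest h)) W.vacuumDom : W.H),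
            (W.cfield (hW.adj ⟨k, a'⟩) (starTest (reflectTest h)) W.vacuumDom : W.H)⟫_ℂ := by
  have hpct := hW.cWightmanFn_two_eq_pct (hW.adjFamily k) (hW.speciesFamily k) a b (starTest h) h
  simp only [adjFamily_idx, speciesFamily_idx, adjFamily_fermi, speciesFamily_fermi, Bool.and_self] at hpct
  have hC : ∀ a a', SL2C.pctMatrix (hW.adjFamily k).R (hW.adjFamily k).continuous_R a a' =
      conj ((SL2C.pctMatrix (W.S k) (hW.continuous_S k) * W.S k (-1)) a a') := fun a a' =>
    SL2C.pctMatrix_of_map_conj_apply (hW.continuous_S k) (hW.adjFamily k).continuous_R (fun A => rfl) a a'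
  have hL : W.cWightmanFn 2 ![hW.adj ⟨k, a⟩, ⟨k, b⟩] ![starTest h, h] =
      ⟪(W.cfield ⟨k, a⟩ h W.vacuumDom : W.H), (W.cfield ⟨k, b⟩ h W.vacuumDom : W.H)⟫_ℂ := by
    rw [cWightmanFn_two, show W.vacuum = (W.vacuumDom : W.H) from rfl, hW.inner_cfield (hW.adj ⟨k, a⟩) (starTest h) _ W.vacuumDom,
      starTest_starTest, hW.cfield_adj_adj, inner_conj_symm]
  have hR : ∀ a' b', W.cWightmanFn 2 ![⟨k, b'⟩, hW.adj ⟨k, a'⟩] ![reflectTest h, reflectTest (starTest h)] =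
      ⟪(W.cfield (hW.adj ⟨k, b'⟩) (starTest (reflectTest h)) W.vacuumDom : W.H),
        (W.cfield (hW.adj ⟨k, a'⟩) (starTest (reflectTest h)) W.vacuumDom : W.H)⟫_ℂ := by
    intro a' b'
    rw [cWightmanFn_two, show W.vacuum = (W.vacuumDom : W.H) from rfl, hW.inner_cfield ⟨k, b'⟩ (reflectTest h) _ W.vacuumDom,
      reflectTest_starTest, inner_conj_symm]
  have hs : (if W.isFermi k = true then (-1 : ℂ) else 1) = W.statSign k := rfl
  rw [hL, hs] at hpct
  rw [hpct]
  congr 1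
  refine Finset.sum_congr rfl fun a' _ => Finset.sum_congr rfl fun b' _ => ?_
  rw [hC, hR]
  rfl

/-- **Positivity**: for a left `(−s)`-eigenvector `c` of `J`, `∑ₐ cₐ φ_{k,a}(h) Ω = 0`
(`‖∑ cₐ tₐ‖² = s ⟪w, −s w⟫ = −‖w‖²`). [cite: StreaterWightman1964, §4-4 eqs. (4-53)–(4-54)] -/
theorem sum_field_vacuum_eq_zero_of_eigen (hW : IsSpinorWightmanQFT W) (k : κ) (c : Fin (W.mult k) → ℂ)
    (hc : ∀ a'', ∑ a, c a * W.S k (-1) a a'' = -W.statSign k * c a'') (h : 𝓢(SpaceTime 3, ℂ)) :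
    ∑ a, c a • (W.cfield ⟨k, a⟩ h W.vacuumDom : W.H) = 0 := by
  set C := SL2C.pctMatrix (W.S k) (hW.continuous_S k) with hCdef
  set J := W.S k (-1) with hJ
  set s := W.statSign k with hsdef
  set t : Fin (W.mult k) → W.H := fun a => (W.cfield ⟨k, a⟩ h W.vacuumDom : W.H) with ht
  set u : Fin (W.mult k) → W.H := fun a => (W.cfield (hW.adj ⟨k, a⟩) (starTest (reflectTest h)) W.vacuumDom : W.H) with hu
  set Y : Fin (W.mult k) → ℂ := fun a' => ∑ a, c a * C a a' with hY
  set X : Fin (W.mult k) → ℂ := fun a' => ∑ a, c a * (C * J) a a' with hX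
  -- `X = −s Y` from `CJ = JC` and the eigen-relation
  have hCJ : C * J = J * C := (SL2C.commute_pctMatrix (W.S k) (hW.continuous_S k) (-1)).eq
  have hXY : ∀ a', X a' = -s * Y a' := by
    intro a'
    simp only [hX, hY]
    rw [hCJ]
    simp only [Matrix.mul_apply, Finset.mul_sum]
    rw [Finset.sum_comm]
    simp only [← mul_assoc, ← Finset.sum_mul, hc]
  -- the two vectors
  set v : W.H := ∑ a, c a • t a with hv
  set w : W.H := ∑ a', conj (Y a') • u a' with hw
  have hvv : ⟪v, v⟫_ℂ = s * ⟪w, ∑ a', conj (X a') • u a'⟫_ℂ := by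
    set T : Fin (W.mult k) → Fin (W.mult k) → Fin (W.mult k) → Fin (W.mult k) → ℂ := fun a b a' b' =>
      conj (c a) * c b * s * conj ((C * J) a a') * C b b' * ⟪u b', u a'⟫_ℂ with hT
    have eL : ⟪v, v⟫_ℂ = ∑ b, ∑ a, ∑ a', ∑ b', T a b a' b' := by
      simp only [hv, sum_inner, inner_sum, inner_smul_left, inner_smul_right, Finset.mul_sum]
      refine Finset.sum_congr rfl fun b _ => Finset.sum_congr rfl fun a _ => ?_
      rw [ht]
      dsimp only
      rw [hW.twoPt_pct k a b h]
      simp only [Finset.mul_sum]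
      refine Finset.sum_congr rfl fun a' _ => Finset.sum_congr rfl fun b' _ => ?_
      simp only [hT, hCdef, hJ, hsdef, hu]
      ring
    have eR : s * ⟪w, ∑ a', conj (X a') • u a'⟫_ℂ = ∑ a', ∑ b', ∑ b, ∑ a, T a b a' b' := by
      simp only [hw, sum_inner, inner_sum, inner_smul_left, inner_smul_right, Complex.conj_conj, Finset.mul_sum]
      refine Finset.sum_congr rfl fun a' _ => Finset.sum_congr rfl fun b' _ => ?_
      simp only [hY, hX, map_sum, map_mul, Finset.sum_mul, Finset.mul_sum]
      refine Finset.sum_congr rfl fun b _ => Finset.sum_congr rfl fun a _ => ?_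
      simp only [hT]
      ring
    rw [eL, eR]
    exact sum_comm_pairs fun b a a' b' => T a b a' b'
  have hXw : ∑ a', conj (X a') • u a' = (-s) • w := by
    rw [hw, Finset.smul_sum]
    refine Finset.sum_congr rfl fun a' _ => ?_
    rw [hXY, smul_smul, map_mul, map_neg, hsdef, conj_statSign]
  rw [hXw, inner_smul_right] at hvv
  have hss : s * (-s) = -1 := by rw [mul_neg, hsdef, statSign_mul_self]
  rw [← mul_assoc, hss, neg_one_mul, inner_self_eq_norm_sq_to_K, inner_self_eq_norm_sq_to_K] at hvv
  have h' : (‖v‖ ^ 2 : ℝ) = -(‖w‖ ^ 2) := by exact_mod_cast hvv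
  have hv0 : ‖v‖ ^ 2 = 0 := by nlinarith [sq_nonneg ‖v‖, sq_nonneg ‖w‖]
  exact norm_eq_zero.1 (pow_eq_zero_iff two_ne_zero |>.1 hv0)

/-- **The wrong-parity part annihilates the vacuum**: `∑_β (P_w)_{αβ} φ_{k,β}(h) Ω = 0`.
[cite: StreaterWightman1964, §4-4 Thm 4-10] -/
theorem wrongProj_field_vacuum_eq_zero (hW : IsSpinorWightmanQFT W) (k : κ) (α : Fin (W.mult k)) (h : 𝓢(SpaceTime 3, ℂ)) :
    W.combField (fun β => W.wrongProj k α β) (fun β => (⟨k, β⟩ : W.Idx)) h W.vacuumDom = 0 := by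
  apply Subtype.ext
  rw [combField_apply, Submodule.coe_sum, Submodule.coe_zero]
  simp only [Submodule.coe_smul]
  refine hW.sum_field_vacuum_eq_zero_of_eigen k _ (fun a'' => ?_) h
  have h := congrArg (fun M : Matrix (Fin (W.mult k)) (Fin (W.mult k)) ℂ => M α a'') (W.wrongProj_mul_S_neg_one k)
  simp only [Matrix.mul_apply, Matrix.neg_apply, Matrix.smul_apply, smul_eq_mul] at h
  rw [h, neg_mul]

/-- **The wrong-parity part of every multiplet vanishes** on `D` (Thm. 4-3 for the combination).
[cite: StreaterWightman1964, §4-4 Thm 4-10] -/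
theorem wrongProj_field_eq_zero (hW : IsSpinorWightmanQFT W) (k : κ) (α : Fin (W.mult k)) (f : 𝓢(SpaceTime 3, ℂ)) :
    W.combField (fun β => W.wrongProj k α β) (fun β => (⟨k, β⟩ : W.Idx)) f = 0 :=
  hW.combField_eq_zero_of_vacuum_eq_zero _ _ (fun _ _ => rfl) (fun g => hW.wrongProj_field_vacuum_eq_zero k α g) f

/-- **`S(−1)` acts on the multiplet as the statistics sign**: `∑_β S(−1)_{αβ} φ_{k,β}(f) ψ = s φ_{k,α}(f) ψ`.
[cite: StreaterWightman1964, §4-4 Thm 4-10] -/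
theorem sum_S_neg_one_field (hW : IsSpinorWightmanQFT W) (k : κ) (α : Fin (W.mult k)) (f : 𝓢(SpaceTime 3, ℂ)) (ψ : W.dom) :
    ∑ β, W.S k (-1) α β • (W.field k β f ψ : W.H) = W.statSign k • (W.field k α f ψ : W.H) := by
  have h := congrArg (fun L : W.dom →ₗ[ℂ] W.dom => ((L ψ : W.dom) : W.H)) (hW.wrongProj_field_eq_zero k α f)
  simp only [combField_apply, LinearMap.zero_apply, Submodule.coe_zero, Submodule.coe_sum, Submodule.coe_smul, cfield_mk,
    wrongProj, Matrix.smul_apply, Matrix.sub_apply, Matrix.one_apply, smul_eq_mul] at h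
  -- `h : ∑ β, 2⁻¹ (δ_{αβ} − s J_{αβ}) • φ_β = 0`
  have h2 : ∑ β, ((if α = β then (1 : ℂ) else 0) - W.statSign k * W.S k (-1) α β) • (W.field k β f ψ : W.H) = 0 := by
    have := congrArg (fun x : W.H => (2 : ℂ) • x) h
    simpa [Finset.smul_sum, smul_smul] using this
  simp only [sub_smul, Finset.sum_sub_distrib, ite_smul, one_smul, zero_smul, Finset.sum_ite_eq, Finset.mem_univ, if_true,
    sub_eq_zero] at h2
  -- `h2 : φ_α = ∑ β, (s J_{αβ}) • φ_β`
  have h3 := congrArg (fun x : W.H => W.statSign k • x) h2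
  simp only [Finset.smul_sum, smul_smul, ← mul_assoc, statSign_mul_self, one_mul] at h3
  exact h3.symm

/-- **`S̄(−1)` acts on the adjoint multiplet as the statistics sign**:
`∑_β conj(S(−1)_{αβ}) φ_{(k,β)†}(g) ψ = s φ_{(k,α)†}(g) ψ` (adjoint of `sum_S_neg_one_field`).
[cite: StreaterWightman1964, §4-4 Thm 4-10] -/
theorem sum_conj_S_neg_one_cfield_adj (hW : IsSpinorWightmanQFT W) (k : κ) (α : Fin (W.mult k)) (g : 𝓢(SpaceTime 3, ℂ)) (ψ : W.dom) :
    ∑ β, conj (W.S k (-1) α β) • (W.cfield (hW.adj ⟨k, β⟩) g ψ : W.H) = W.statSign k • (W.cfield (hW.adj ⟨k, α⟩) g ψ : W.H) := by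
  refine Dense.eq_of_inner_left ℂ hW.dense_dom fun v hv => ?_
  rw [sum_inner, inner_smul_left, conj_statSign]
  simp only [inner_smul_left, Complex.conj_conj]
  have h : ∀ β, ⟪(W.cfield (hW.adj ⟨k, β⟩) g ψ : W.H), v⟫_ℂ = ⟪(ψ : W.H), (W.field k β (starTest g) ⟨v, hv⟩ : W.H)⟫_ℂ := by
    intro β
    rw [← inner_conj_symm, hW.inner_cfield (hW.adj ⟨k, β⟩) g ψ ⟨v, hv⟩, Complex.conj_conj, hW.cfield_adj_adj, cfield_mk]
  simp only [h, ← inner_smul_right, ← inner_sum, hW.sum_S_neg_one_field k α (starTest g) ⟨v, hv⟩]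

/-! ### Iterated actions on monomials -/

/-- **Iterating a letterwise matrix action over a monomial**: if `∑_b J_j(a,b) φ_{idx j b} = s_j φ_{idx j a}`
for each slot `j`, then `∑_β ∏ⱼ J_j(αⱼ, βⱼ) φ_{idx β}(f) ψ = (∏ⱼ sⱼ) φ_{idx α}(f) ψ`. [folklore] -/
theorem sum_prod_cMonomial_of_action (W : SpinorWightmanData κ) :
    ∀ {n : ℕ} {m : Fin n → ℕ} (idx : (j : Fin n) → Fin (m j) → W.Idx) (J : (j : Fin n) → Matrix (Fin (m j)) (Fin (m j)) ℂ)
      (s : Fin n → ℂ)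
      (_hJ : ∀ j a (g : 𝓢(SpaceTime 3, ℂ)) (ψ : W.dom), ∑ b, J j a b • (W.cfield (idx j b) g ψ : W.H) = s j • (W.cfield (idx j a) g ψ : W.H))
      (α : (j : Fin n) → Fin (m j)) (f : Fin n → 𝓢(SpaceTime 3, ℂ)) (ψ : W.dom),
      ∑ β : (j : Fin n) → Fin (m j), (∏ j, J j (α j) (β j)) • (W.cMonomial (List.ofFn fun j => (idx j (β j), f j)) ψ : W.H) =
        (∏ j, s j) • (W.cMonomial (List.ofFn fun j => (idx j (α j), f j)) ψ : W.H) := by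
  intro n
  induction n with
  | zero =>
    intro m idx J s _ α f ψ
    simp [List.ofFn_zero]
  | succ p ih =>
    intro m idx J s hJ α f ψ
    rw [← (Fin.consEquiv fun j => Fin (m j)).sum_comp, Fintype.sum_prod_type]
    simp only [Fin.consEquiv_apply, Fin.prod_univ_succ, Fin.cons_zero, Fin.cons_succ]
    have hsplit : ∀ (β₀ : Fin (m 0)) (β' : (j : Fin p) → Fin (m j.succ)),
        (W.cMonomial (List.ofFn fun j => (idx j ((Fin.cons β₀ β' : (j : Fin (p + 1)) → Fin (m j)) j), f j)) ψ : W.H) =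
          (W.cfield (idx 0 β₀) (f 0) (W.cMonomial (List.ofFn fun j => (idx j.succ (β' j), f j.succ)) ψ) : W.H) := by
      intro β₀ β'
      rw [List.ofFn_succ, cMonomial_cons]
      simp only [Fin.cons_zero, Fin.cons_succ, LinearMap.comp_apply]
    simp_rw [hsplit, mul_smul, ← Finset.smul_sum]
    have htail := ih (m := fun j : Fin p => m j.succ) (fun j => idx j.succ) (fun j => J j.succ) (fun j => s j.succ)
      (fun j => hJ j.succ) (fun j => α j.succ) (fun j => f j.succ) ψ
    have htail' : ∀ β₀ : Fin (m 0),
        ∑ β' : (j : Fin p) → Fin (m j.succ), (∏ j : Fin p, J j.succ (α j.succ) (β' j)) •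
          (W.cfield (idx 0 β₀) (f 0) (W.cMonomial (List.ofFn fun j => (idx j.succ (β' j), f j.succ)) ψ) : W.H) =
        (∏ j : Fin p, s j.succ) • (W.cfield (idx 0 β₀) (f 0) (W.cMonomial (List.ofFn fun j => (idx j.succ (α j.succ), f j.succ)) ψ) : W.H) := by
      intro β₀
      have hvec : (∑ β' : (j : Fin p) → Fin (m j.succ), (∏ j : Fin p, J j.succ (α j.succ) (β' j)) •
            W.cMonomial (List.ofFn fun j => (idx j.succ (β' j), f j.succ)) ψ : W.dom) =
          (∏ j : Fin p, s j.succ) • W.cMonomial (List.ofFn fun j => (idx j.succ (α j.succ), f j.succ)) ψ :=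
        Subtype.ext (by simpa only [Submodule.coe_sum, Submodule.coe_smul] using htail)
      have hlin := congrArg (fun x : W.dom => ((W.cfield (idx 0 β₀) (f 0) x : W.dom) : W.H)) hvec
      simpa only [map_sum, map_smul, Submodule.coe_sum, Submodule.coe_smul] using hlin
    simp_rw [htail', smul_comm _ (∏ j : Fin p, s j.succ), ← Finset.smul_sum, hJ 0, smul_smul]
    rw [mul_comm (∏ j : Fin p, s j.succ) (s 0)]
    congr 1
    conv_rhs => rw [List.ofFn_succ, cMonomial_cons]
    simp only [LinearMap.comp_apply]

/-- The species instance: `∑_β ∏ⱼ S_{kⱼ}(−1)_{αⱼβⱼ} φ_{k,β}(f) ψ = (∏ⱼ s_{kⱼ}) φ_{k,α}(f) ψ`. [cite: StreaterWightman1964, §4-4 Thm 4-10] -/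
theorem sum_prod_S_neg_one_cMonomial (hW : IsSpinorWightmanQFT W) {n : ℕ} (k : Fin n → κ) (α : W.MIdx k)
    (f : Fin n → 𝓢(SpaceTime 3, ℂ)) (ψ : W.dom) :
    ∑ β : W.MIdx k, (∏ j, W.S (k j) (-1) (α j) (β j)) • (W.cMonomial (List.ofFn fun j => ((⟨k j, β j⟩ : W.Idx), f j)) ψ : W.H) =
      (∏ j, W.statSign (k j)) • (W.cMonomial (List.ofFn fun j => ((⟨k j, α j⟩ : W.Idx), f j)) ψ : W.H) :=
  sum_prod_cMonomial_of_action W (fun j b => (⟨k j, b⟩ : W.Idx)) (fun j => W.S (k j) (-1)) (fun j => W.statSign (k j))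
    (fun j a g ψ => by simpa only [cfield_mk] using hW.sum_S_neg_one_field (k j) a g ψ) α f ψ

/-- The adjoint instance: `∑_β ∏ⱼ conj(S_{kⱼ}(−1)_{αⱼβⱼ}) φ_{(kⱼ,βⱼ)†}(f) ψ = (∏ⱼ s_{kⱼ}) φ_{(k,α)†}(f) ψ`.
[cite: StreaterWightman1964, §4-4 Thm 4-10] -/
theorem sum_prod_conj_S_neg_one_cMonomial_adj (hW : IsSpinorWightmanQFT W) {n : ℕ} (k : Fin n → κ) (α : W.MIdx k)
    (f : Fin n → 𝓢(SpaceTime 3, ℂ)) (ψ : W.dom) :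
    ∑ β : W.MIdx k, (∏ j, conj (W.S (k j) (-1) (α j) (β j))) •
        (W.cMonomial (List.ofFn fun j => (hW.adj ⟨k j, β j⟩, f j)) ψ : W.H) =
      (∏ j, W.statSign (k j)) • (W.cMonomial (List.ofFn fun j => (hW.adj ⟨k j, α j⟩, f j)) ψ : W.H) :=
  sum_prod_cMonomial_of_action W (fun j b => hW.adj ⟨k j, b⟩) (fun j => (W.S (k j) (-1)).map conj) (fun j => W.statSign (k j))
    (fun j a g ψ => hW.sum_conj_S_neg_one_cfield_adj (k j) a g ψ) α f ψ

/-! ### The rotation by `2π` and Wightman functions with an odd number of Fermi fields -/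

/-- `(−1)⁻¹ = −1` in `SL(2, ℂ)`. [folklore] -/
theorem inv_neg_one_SL2 : (-1 : SL(2, ℂ))⁻¹ = -1 :=
  inv_eq_of_mul_eq_one_right (by rw [neg_mul_neg, one_mul])

/-- `(0, Λ(−1)) • f = f`. [folklore] -/
theorem poincareTest_gSL_neg_one (f : 𝓢(SpaceTime 3, ℂ)) : poincareTest (gSL (-1)) f = f := by
  have h : gSL (-1) = gSL 1 := by
    show SemidirectProduct.inr (spinCoverHom (-1)) = SemidirectProduct.inr (spinCoverHom 1)
    simp only [spinCoverHom_neg_one, map_one]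
  rw [h, poincareTest_gSL_one]

/-- **The rotation by `2π` passes a component with the statistics sign**:
`U(−1) φ_i(f) ψ = s_i φ_i(f) U(−1) ψ`. [cite: StreaterWightman1964, §4-4 Thm 4-10] -/
theorem spinRep_neg_one_cfield (hW : IsSpinorWightmanQFT W) (i : W.Idx) (f : 𝓢(SpaceTime 3, ℂ)) (ψ : W.dom) :
    (W.spinRep (-1) : W.H →L[ℂ] W.H) (W.cfield i f ψ : W.H) =
      W.statSign i.1 • (W.cfield i f ⟨(W.spinRep (-1) : W.H →L[ℂ] W.H) ψ, hW.spinRep_dom (-1) _ ψ.2⟩ : W.H) := by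
  obtain ⟨k, α⟩ := i
  rw [cfield_mk, hW.spinRep_field (-1) k α f ψ]
  simp only [inv_neg_one_SL2, poincareTest_gSL_neg_one]
  exact hW.sum_S_neg_one_field k α f _

/-- **The rotation by `2π` on a monomial vector**: `U(−1) φ(l) Ω = (∏ s) φ(l) Ω`. [cite: StreaterWightman1964, §4-4 Thm 4-10] -/
theorem spinRep_neg_one_cmonomialVec (hW : IsSpinorWightmanQFT W) (l : List W.CLetter) :
    (W.spinRep (-1) : W.H →L[ℂ] W.H) (W.cmonomialVec l : W.H) = W.listStatSign l • (W.cmonomialVec l : W.H) := by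
  induction l with
  | nil => simp [listStatSign, hW.spinRep_vacuum]
  | cons p l ih =>
    rw [cmonomialVec_cons, hW.spinRep_neg_one_cfield]
    have ih' : (⟨(W.spinRep (-1) : W.H →L[ℂ] W.H) (W.cmonomialVec l : W.H), hW.spinRep_dom (-1) _ (W.cmonomialVec l).2⟩ : W.dom) =
        W.listStatSign l • W.cmonomialVec l := Subtype.ext (by simpa only [Submodule.coe_smul] using ih)
    rw [ih', map_smul, Submodule.coe_smul, smul_smul]
    simp only [listStatSign, List.map_cons, List.prod_cons]

/-- **Vacuum expectation values of monomials with sign product `−1` vanish** (invariance of `Ω`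
under `U(−1)`). [cite: StreaterWightman1964, §4-3 Thm 4-7] -/
theorem inner_vacuum_cmonomialVec_eq_zero (hW : IsSpinorWightmanQFT W) (l : List W.CLetter) (h : W.listStatSign l = -1) :
    ⟪W.vacuum, (W.cmonomialVec l : W.H)⟫_ℂ = 0 := by
  have h1 := Unitary.inner_map_map (W.spinRep (-1)) W.vacuum (W.cmonomialVec l : W.H)
  rw [hW.spinRep_vacuum, hW.spinRep_neg_one_cmonomialVec, h, inner_smul_right, neg_one_mul] at h1
  -- `h1 : -x = x`
  have : (2 : ℂ) * ⟪W.vacuum, (W.cmonomialVec l : W.H)⟫_ℂ = 0 := by rw [two_mul]; nth_rewrite 1 [← h1]; ring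
  simpa using this

/-- **Wightman functions of letters with an odd number of Fermi letters vanish.** [cite: StreaterWightman1964, §4-3 Thm 4-7] -/
theorem cWightmanFn_eq_zero_of_odd (hW : IsSpinorWightmanQFT W) {n : ℕ} (i : Fin n → W.Idx) (f : Fin n → 𝓢(SpaceTime 3, ℂ))
    (hodd : Odd (Finset.univ.filter fun j => W.isFermi (i j).1 = true).card) : W.cWightmanFn n i f = 0 :=
  hW.inner_vacuum_cmonomialVec_eq_zero (List.ofFn fun j => (i j, f j)) (by rw [listStatSign_ofFn, hodd.neg_one_pow])

/-- **Wightman functions with an odd number of Fermi fields vanish.** [cite: StreaterWightman1964, §4-3 Thm 4-7] -/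
theorem wightmanFn_eq_zero_of_odd (hW : IsSpinorWightmanQFT W) {n : ℕ} (k : Fin n → κ) (α : W.MIdx k)
    (f : Fin n → 𝓢(SpaceTime 3, ℂ)) (hodd : Odd (Finset.univ.filter fun j => W.isFermi (k j) = true).card) :
    W.wightmanFn n k α f = 0 := by
  have h := hW.cWightmanFn_eq_zero_of_odd (fun j => (⟨k j, α j⟩ : W.Idx)) f hodd
  rwa [W.cWightmanFn_eq_wightmanFn] at h

end IsSpinorWightmanQFT

end Literature.Analysis.FunctionSpaces
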